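import Summits.AtomisticToContinuum.Crystallization.Theorems.HullExactificationCascadeZeroDefectDensityLinkLemma
import HarnessLib

/-!
# Quantitative link lemma for the birth line — part 1/2: scalar and planar bookkeeping
# (route `HullExactificationCascade`, crux `ZeroDefectDensity`, stmt-AtomisticToContinuum-12086; line `birth`,
# stub `stub_linkQ`; this part lands the registered sub-goal `linkQ_planar`)

Setting of the link lemma (`stub_linkLemma`): apex `p`, shell vertex `c`, the four common soft
contacts `n₁, …, n₄` of `p` and `c`, all eleven lengths in the band `[1 - η, 1 + η]`,
`η ≤ 1/1000`.  NEW: two "square" pairs are pinned, `|d² - 2| ≤ 38 η`.  Conclusions: the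
near-antipodal pairs have `|d² - 3| ≤ 40 η` and the type-B two-contact pair has `|d² - 8/3| ≤ 60 η`.

Proof.  Everything is first order in `η`, in the cylindrical frame of `a = p - c` (`link_frame`):
for `bᵢ = nᵢ - c` the axis component is `αᵢ = 1/2 ± 2.51 η`, the squared planar radius
`ρᵢ² = 3/4 ± 4.53 η` (`linkQ_vpoint`); a soft contact has planar cosine `1/3 ± 9.5 η`
(`linkQ_vcontact`), a pinned square `-1/3 ± 33.7 η` (`linkQ_vsquare`).  Planar part: composing a
contact rotation with a square rotation of the opposite sense (the same sense is excluded by the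
far hypothesis) gives a cosine in `[-1, -1 + 1.09 η]` — the antipode is a STATIONARY point of the
cosine, so only the square `(43.2 η)²/2 · (1 + 0.144) ≤ 1.07 η` of the azimuth error survives
(`linkQ_antipodal`); composing two contact rotations gives `-7/9 ± 12.9 η` (`linkQ_twoContacts`).
Back in space, `d² = ‖bᵢ‖² + ‖bⱼ‖² - 2 (ρᵢ ρⱼ cos + αᵢ αⱼ)` is `3 ± 19.8 η`, resp. `8/3 ± 35.6 η`
(`linkQ_vbackA`, `linkQ_vbackB`); the registered constants `40`, `60` have slack.

Mathlib + the two landed link-lemma files; no named fact is used.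
-/

noncomputable section

namespace Summit.AtomisticToContinuum.Crystallization.Theorems.ZeroDefectDensityBirth

open scoped InnerProductSpace

/-! ## Scalar bookkeeping, first order in `η` -/

/-- A band length squared: `|B² - 1| ≤ 2.001 η`. [folklore] -/
theorem linkQ_sq {η B : ℝ} (hη0 : 0 ≤ η) (hη : η ≤ 1 / 1000) (h1 : 1 - η ≤ B) (h2 : B ≤ 1 + η) :
    |B ^ 2 - 1| ≤ 2.001 * η := by
  rw [abs_le]
  constructor <;> nlinarith

/-- Axis component of a band point: `|α - 1/2| ≤ 2.51 η`
(`α ‖a‖ = (‖b‖² + ‖a‖² - ‖a - b‖²)/2`). [folklore] -/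
theorem linkQ_alpha {η A B D α : ℝ} (hη0 : 0 ≤ η) (hη : η ≤ 1 / 1000) (hA : 1 - η ≤ A)
    (hA' : A ≤ 1 + η) (hB : 1 - η ≤ B) (hB' : B ≤ 1 + η) (hD : 1 - η ≤ D) (hD' : D ≤ 1 + η)
    (hα : α * A = (B ^ 2 + A ^ 2 - D ^ 2) / 2) : |α - 1 / 2| ≤ 2.51 * η := by
  have hA0 : 0 < A := by linarith
  have hBD : B ^ 2 - D ^ 2 ≤ 4 * η := by nlinarith
  have hBD' : -(4 * η) ≤ B ^ 2 - D ^ 2 := by nlinarith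
  rw [abs_le]
  constructor
  · by_contra h
    nlinarith [mul_lt_mul_of_pos_right (not_le.mp h) hA0, mul_le_mul_of_nonneg_left hA hA0.le]
  · by_contra h
    nlinarith [mul_lt_mul_of_pos_right (not_le.mp h) hA0, mul_le_mul_of_nonneg_left hA' hA0.le]

/-- Product of two axis components: `|α₁ α₂ - 1/4| ≤ 2.52 η`. [folklore] -/
theorem linkQ_alphaMul {η α₁ α₂ : ℝ} (hη0 : 0 ≤ η) (hη : η ≤ 1 / 1000)
    (h₁ : |α₁ - 1 / 2| ≤ 2.51 * η) (h₂ : |α₂ - 1 / 2| ≤ 2.51 * η) :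
    |α₁ * α₂ - 1 / 4| ≤ 2.52 * η := by
  obtain ⟨h₁l, h₁u⟩ := abs_le.mp h₁
  obtain ⟨h₂l, h₂u⟩ := abs_le.mp h₂
  have key : α₁ * α₂ - 1 / 4 = (α₁ - 1 / 2) * (α₂ - 1 / 2) + ((α₁ - 1 / 2) + (α₂ - 1 / 2)) / 2 := by
    ring
  have hp : |(α₁ - 1 / 2) * (α₂ - 1 / 2)| ≤ 2.51 * η * (2.51 * η) := by
    rw [abs_mul]
    exact mul_le_mul h₁ h₂ (abs_nonneg _) (by positivity)
  obtain ⟨hpl, hpu⟩ := abs_le.mp hp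
  rw [abs_le, key]
  constructor <;> nlinarith

/-- Squared planar radius: `|ρ² - 3/4| ≤ 4.53 η`. [folklore] -/
theorem linkQ_rhoSq {η B α R : ℝ} (hR : R = B ^ 2 - α ^ 2) (hB : |B ^ 2 - 1| ≤ 2.001 * η)
    (hα : |α * α - 1 / 4| ≤ 2.52 * η) : |R - 3 / 4| ≤ 4.53 * η := by
  obtain ⟨hBl, hBu⟩ := abs_le.mp hB
  obtain ⟨hαl, hαu⟩ := abs_le.mp hα
  rw [abs_le, hR]
  constructor <;> nlinarith

/-- Product of two planar radii: `|ρ₁ ρ₂ - 3/4| ≤ 4.53 η` (it lies between `ρ₁²` and `ρ₂²`).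
[folklore] -/
theorem linkQ_prod {η ρ₁ ρ₂ : ℝ} (h₁ : 0 < ρ₁) (h₂ : 0 < ρ₂) (h₁' : |ρ₁ ^ 2 - 3 / 4| ≤ 4.53 * η)
    (h₂' : |ρ₂ ^ 2 - 3 / 4| ≤ 4.53 * η) : |ρ₁ * ρ₂ - 3 / 4| ≤ 4.53 * η := by
  obtain ⟨h₁l, h₁u⟩ := abs_le.mp h₁'
  obtain ⟨h₂l, h₂u⟩ := abs_le.mp h₂'
  rw [abs_le]
  rcases le_total ρ₁ ρ₂ with h | h
  · constructor
    · nlinarith [mul_le_mul_of_nonneg_left h h₁.le]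
    · nlinarith [mul_le_mul_of_nonneg_right h h₂.le]
  · constructor
    · nlinarith [mul_le_mul_of_nonneg_right h h₂.le]
    · nlinarith [mul_le_mul_of_nonneg_left h h₁.le]

/-- Inner product of a soft contact pair: `|g - 1/2| ≤ 3.01 η`. [folklore] -/
theorem linkQ_gContact {η g B₁ B₂ D : ℝ} (hD : D ^ 2 = B₁ ^ 2 - 2 * g + B₂ ^ 2)
    (hB₁ : |B₁ ^ 2 - 1| ≤ 2.001 * η) (hB₂ : |B₂ ^ 2 - 1| ≤ 2.001 * η)
    (hDb : |D ^ 2 - 1| ≤ 2.001 * η) : |g - 1 / 2| ≤ 3.01 * η := by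
  obtain ⟨_, _⟩ := abs_le.mp hB₁
  obtain ⟨_, _⟩ := abs_le.mp hB₂
  obtain ⟨_, _⟩ := abs_le.mp hDb
  rw [abs_le]
  constructor <;> linarith

/-- Inner product of a pinned square pair: `|g| ≤ 21.01 η`. [folklore] -/
theorem linkQ_gSquare {η g B₁ B₂ D : ℝ} (hD : D ^ 2 = B₁ ^ 2 - 2 * g + B₂ ^ 2)
    (hB₁ : |B₁ ^ 2 - 1| ≤ 2.001 * η) (hB₂ : |B₂ ^ 2 - 1| ≤ 2.001 * η)
    (hDs : |D ^ 2 - 2| ≤ 38 * η) : |g| ≤ 21.01 * η := by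
  obtain ⟨_, _⟩ := abs_le.mp hB₁
  obtain ⟨_, _⟩ := abs_le.mp hB₂
  obtain ⟨_, _⟩ := abs_le.mp hDs
  rw [abs_le]
  constructor <;> linarith

/-- Planar cosine of a soft contact pair: `|C - 1/3| ≤ 9.5 η`
(`g = P C + α₁ α₂`, `P = ρ₁ ρ₂`). [folklore] -/
theorem linkQ_cosContact {η g P C αα : ℝ} (hg : g = P * C + αα) (hP : 0.7449 ≤ P)
    (hPk : |P - 3 / 4| ≤ 4.53 * η) (hαα : |αα - 1 / 4| ≤ 2.52 * η)
    (hgk : |g - 1 / 2| ≤ 3.01 * η) : |C - 1 / 3| ≤ 9.5 * η := by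
  obtain ⟨_, _⟩ := abs_le.mp hPk
  obtain ⟨_, _⟩ := abs_le.mp hαα
  obtain ⟨_, _⟩ := abs_le.mp hgk
  have key : P * (C - 1 / 3) = (g - 1 / 2) - (αα - 1 / 4) - (P - 3 / 4) / 3 := by
    rw [hg]; ring
  have h1 : P * (C - 1 / 3) ≤ 7.04 * η := by rw [key]; linarith
  have h2 : -(7.04 * η) ≤ P * (C - 1 / 3) := by rw [key]; linarith
  rw [abs_le]
  constructor
  · by_contra h
    nlinarith [mul_lt_mul_of_pos_left (not_le.mp h) (by linarith : (0 : ℝ) < P)]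
  · by_contra h
    nlinarith [mul_lt_mul_of_pos_left (not_le.mp h) (by linarith : (0 : ℝ) < P)]

/-- Planar cosine of a pinned square pair: `|C + 1/3| ≤ 33.7 η`. [folklore] -/
theorem linkQ_cosSquare {η g P C αα : ℝ} (hg : g = P * C + αα) (hP : 0.7449 ≤ P)
    (hPk : |P - 3 / 4| ≤ 4.53 * η) (hαα : |αα - 1 / 4| ≤ 2.52 * η) (hgk : |g| ≤ 21.01 * η) :
    |C + 1 / 3| ≤ 33.7 * η := by
  obtain ⟨_, _⟩ := abs_le.mp hPk
  obtain ⟨_, _⟩ := abs_le.mp hαα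
  obtain ⟨_, _⟩ := abs_le.mp hgk
  have key : P * (C + 1 / 3) = g - (αα - 1 / 4) + (P - 3 / 4) / 3 := by
    rw [hg]; ring
  have h1 : P * (C + 1 / 3) ≤ 25.04 * η := by rw [key]; linarith
  have h2 : -(25.04 * η) ≤ P * (C + 1 / 3) := by rw [key]; linarith
  rw [abs_le]
  constructor
  · by_contra h
    nlinarith [mul_lt_mul_of_pos_left (not_le.mp h) (by linarith : (0 : ℝ) < P)]
  · by_contra h
    nlinarith [mul_lt_mul_of_pos_left (not_le.mp h) (by linarith : (0 : ℝ) < P)]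

/-- Back to the chord, near-antipodal pair: planar cosine in `[-1, -1 + 1.09 η]` gives
`|d² - 3| ≤ 40 η` (in fact `≤ 19.8 η`). [folklore] -/
theorem linkQ_backA {η g P C αα B₁ B₂ D : ℝ} (hη0 : 0 ≤ η) (hD : D ^ 2 = B₁ ^ 2 - 2 * g + B₂ ^ 2)
    (hg : g = P * C + αα) (hB₁ : |B₁ ^ 2 - 1| ≤ 2.001 * η) (hB₂ : |B₂ ^ 2 - 1| ≤ 2.001 * η)
    (hPk : |P - 3 / 4| ≤ 4.53 * η) (hP1 : 0 ≤ P) (hP2 : P ≤ 0.755)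
    (hαα : |αα - 1 / 4| ≤ 2.52 * η) (hC1 : -1 ≤ C) (hC2 : C ≤ -1 + 1.09 * η) :
    |D ^ 2 - 3| ≤ 40 * η := by
  obtain ⟨_, _⟩ := abs_le.mp hPk
  obtain ⟨_, _⟩ := abs_le.mp hαα
  obtain ⟨_, _⟩ := abs_le.mp hB₁
  obtain ⟨_, _⟩ := abs_le.mp hB₂
  have key : D ^ 2 - 3 = (B₁ ^ 2 - 1) + (B₂ ^ 2 - 1) + 2 * (P - 3 / 4) - 2 * (αα - 1 / 4)
      - 2 * (P * (C + 1)) := by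
    rw [hD, hg]; ring
  have h1 : 0 ≤ P * (C + 1) := mul_nonneg hP1 (by linarith)
  have h2 : P * (C + 1) ≤ 0.755 * (1.09 * η) :=
    mul_le_mul hP2 (by linarith) (by linarith) (by norm_num)
  rw [abs_le, key]
  constructor <;> nlinarith

/-- Back to the chord, two-contact pair: planar cosine `-7/9 ± 12.9 η` gives
`|d² - 8/3| ≤ 60 η` (in fact `≤ 35.6 η`). [folklore] -/
theorem linkQ_backB {η g P C αα B₁ B₂ D : ℝ} (hη0 : 0 ≤ η) (hD : D ^ 2 = B₁ ^ 2 - 2 * g + B₂ ^ 2)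
    (hg : g = P * C + αα) (hB₁ : |B₁ ^ 2 - 1| ≤ 2.001 * η) (hB₂ : |B₂ ^ 2 - 1| ≤ 2.001 * η)
    (hPk : |P - 3 / 4| ≤ 4.53 * η) (hP1 : 0 ≤ P) (hP2 : P ≤ 0.755)
    (hαα : |αα - 1 / 4| ≤ 2.52 * η) (hC : |C + 7 / 9| ≤ 12.9 * η) :
    |D ^ 2 - 8 / 3| ≤ 60 * η := by
  obtain ⟨_, _⟩ := abs_le.mp hPk
  obtain ⟨_, _⟩ := abs_le.mp hαα
  obtain ⟨_, _⟩ := abs_le.mp hB₁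
  obtain ⟨_, _⟩ := abs_le.mp hB₂
  obtain ⟨hCl, hCu⟩ := abs_le.mp hC
  have key : D ^ 2 - 8 / 3 = (B₁ ^ 2 - 1) + (B₂ ^ 2 - 1) + 14 / 9 * (P - 3 / 4)
      - 2 * (αα - 1 / 4) - 2 * (P * (C + 7 / 9)) := by
    rw [hD, hg]; ring
  have h1 : P * (C + 7 / 9) ≤ 0.755 * (12.9 * η) := by
    nlinarith [mul_le_mul_of_nonneg_left hCu hP1]
  have h2 : -(0.755 * (12.9 * η)) ≤ P * (C + 7 / 9) := by
    nlinarith [mul_le_mul_of_nonneg_left hCl hP1]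
  rw [abs_le, key]
  constructor <;> nlinarith

/-! ## Planar compositions: scalar cores -/

/-- Same-sense exclusion, contact then square: `C C₂ + X ≤ -0.136` is impossible for
`0 ≤ C ≤ 0.3429`, `C₂ ≥ -0.3671`, `X ≥ 0`. [folklore] -/
theorem linkQ_sameSenseA {C C₂ X : ℝ} (hC0 : 0 ≤ C) (hC : C ≤ 0.3429) (hC₂ : -0.3671 ≤ C₂)
    (hX : 0 ≤ X) (h : C * C₂ + X ≤ -0.136) : False := by
  nlinarith [mul_nonneg hC0 (by linarith : 0 ≤ C₂ + 0.3671)]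

/-- Sine of a contact rotation: `|C - 1/3| ≤ 9.5 η`, `σ² = 1 - C²`, `σ ≥ 0` give `σ ≥ 0.9393`
and `σ² = 8/9 ± …`. [folklore] -/
theorem linkQ_sinContact {η C σ : ℝ} (hη0 : 0 ≤ η) (hη : η ≤ 1 / 1000)
    (hC : |C - 1 / 3| ≤ 9.5 * η) (hσ0 : 0 ≤ σ) (hσ : σ ^ 2 = 1 - C ^ 2) :
    0.9393 ≤ σ ∧ 8 / 9 - 2 / 3 * (9.5 * η) - (9.5 * η) ^ 2 ≤ σ ^ 2 ∧
      σ ^ 2 ≤ 8 / 9 + 2 / 3 * (9.5 * η) := by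
  obtain ⟨hCl, hCu⟩ := abs_le.mp hC
  have hC0 : 0 ≤ C := by linarith
  have hL : 1 / 3 - 9.5 * η ≤ C := by linarith
  have hU : C ≤ 1 / 3 + 9.5 * η := by linarith
  refine ⟨?_, by nlinarith [mul_le_mul hU hU hC0 (by linarith)],
    by nlinarith [mul_le_mul hL hL (by linarith) hC0]⟩
  by_contra h
  have h' := not_le.mp h
  have hU' : C ≤ 0.3428334 := by linarith
  nlinarith [mul_le_mul hU' hU' hC0 (by norm_num), mul_lt_mul'' h' h' hσ0 hσ0]

/-- Sine of a square rotation: `|C + 1/3| ≤ 33.7 η`, `τ² = 1 - C²`, `τ ≥ 0` give `τ ≥ 0.9301`.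
[folklore] -/
theorem linkQ_sinSquare {η C τ : ℝ} (hη : η ≤ 1 / 1000) (hC : |C + 1 / 3| ≤ 33.7 * η)
    (hτ0 : 0 ≤ τ) (hτ : τ ^ 2 = 1 - C ^ 2) : 0.9301 ≤ τ := by
  obtain ⟨hCl, hCu⟩ := abs_le.mp hC
  by_contra h
  have h' := not_le.mp h
  nlinarith [mul_le_mul_of_nonpos_right hCl (by linarith : C ≤ 0), mul_lt_mul'' h' h' hτ0 hτ0]

/-- A product of two nonnegative reals lies between the min and the max of their squares.
[folklore] -/
theorem linkQ_between {σ τ m U : ℝ} (hσ : 0 ≤ σ) (hτ : 0 ≤ τ) (h1 : m ≤ σ ^ 2) (h2 : σ ^ 2 ≤ U)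
    (h3 : m ≤ τ ^ 2) (h4 : τ ^ 2 ≤ U) : m ≤ σ * τ ∧ σ * τ ≤ U := by
  rcases le_total σ τ with h | h
  · exact ⟨by nlinarith [mul_le_mul_of_nonneg_left h hσ],
      by nlinarith [mul_le_mul_of_nonneg_right h hτ]⟩
  · exact ⟨by nlinarith [mul_le_mul_of_nonneg_right h hτ],
      by nlinarith [mul_le_mul_of_nonneg_left h hσ]⟩

/-- Product of two contact cosines: `C C₂ = 1/9 ± (2/3 · 9.5 η + (9.5 η)²)`. [folklore] -/
theorem linkQ_mulThird {η C C₂ : ℝ} (hη : η ≤ 1 / 1000) (h1 : |C - 1 / 3| ≤ 9.5 * η)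
    (h2 : |C₂ - 1 / 3| ≤ 9.5 * η) :
    |C * C₂ - 1 / 9| ≤ 2 / 3 * (9.5 * η) + (9.5 * η) ^ 2 := by
  obtain ⟨h1l, h1u⟩ := abs_le.mp h1
  obtain ⟨h2l, h2u⟩ := abs_le.mp h2
  have hL : (0 : ℝ) ≤ 1 / 3 - 9.5 * η := by linarith
  rw [abs_le]
  constructor
  · nlinarith [mul_le_mul (by linarith : 1 / 3 - 9.5 * η ≤ C) (by linarith : 1 / 3 - 9.5 * η ≤ C₂)
      hL (by linarith)]
  · nlinarith [mul_le_mul (by linarith : C ≤ 1 / 3 + 9.5 * η) (by linarith : C₂ ≤ 1 / 3 + 9.5 * η)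
      (by linarith) (by linarith)]

/-- **Stationarity at the antipode.**  For a contact cosine `C = 1/3 ± 9.5 η` with sine
`σ ≥ 0.9393` and a square cosine `C₂ = -1/3 ± 33.7 η` with sine `τ ≥ 0.9301`:
`(C + C₂)² + (σ - τ)² ≤ 2.18 η`, because `(σ - τ)(σ + τ) = C₂² - C²` makes
`(σ - τ)² ≤ 0.1443 (C + C₂)²` and `|C + C₂| ≤ 43.2 η`. [folklore] -/
theorem linkQ_antipodalCore {η C C₂ σ τ : ℝ} (hη0 : 0 ≤ η) (hη : η ≤ 1 / 1000)
    (h1 : |C - 1 / 3| ≤ 9.5 * η) (h2 : |C₂ + 1 / 3| ≤ 33.7 * η) (hσ : 0.9393 ≤ σ)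
    (hτ : 0.9301 ≤ τ) (hσ2 : σ ^ 2 = 1 - C ^ 2) (hτ2 : τ ^ 2 = 1 - C₂ ^ 2) :
    (C + C₂) ^ 2 + (σ - τ) ^ 2 ≤ 2 * (1.09 * η) := by
  obtain ⟨h1l, h1u⟩ := abs_le.mp h1
  obtain ⟨h2l, h2u⟩ := abs_le.mp h2
  have hprod : (σ - τ) ^ 2 * (σ + τ) ^ 2 = (C + C₂) ^ 2 * (C - C₂) ^ 2 := by
    have h : (σ - τ) * (σ + τ) = C₂ ^ 2 - C ^ 2 := by linear_combination hσ2 - hτ2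
    rw [← mul_pow, h]
    ring
  have hst : 0.9393 + 0.9301 ≤ σ + τ := by linarith
  have hsum : 3.4946 ≤ (σ + τ) ^ 2 := by nlinarith [mul_le_mul hst hst (by norm_num) (by linarith)]
  have hd1 : C - C₂ ≤ 0.71 := by linarith
  have hd2 : 0 ≤ C - C₂ := by linarith
  have hdiff : (C - C₂) ^ 2 ≤ 0.5041 := by nlinarith [mul_le_mul hd1 hd1 hd2 (by norm_num)]
  have hΔ : (σ - τ) ^ 2 ≤ 0.14426 * (C + C₂) ^ 2 := by
    nlinarith [mul_le_mul_of_nonneg_left hsum (sq_nonneg (σ - τ)),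
      mul_le_mul_of_nonneg_left hdiff (sq_nonneg (C + C₂))]
  have hsumC : (C + C₂) ^ 2 ≤ (43.2 * η) ^ 2 := sq_le_sq' (by linarith) (by linarith)
  nlinarith [mul_le_mul_of_nonneg_left hη hη0]

/-! ## Planar compositions -/

/-- **Contact then square is antipodal, to second order.**  Unit vectors `e₁, e₂, e₃` of the
plane with `⟪e₁, e₂⟫ = 1/3 ± 9.5 η`, `⟪e₂, e₃⟫ = -1/3 ± 33.7 η` and `⟪e₁, e₃⟫ ≤ -0.136`: then
`-1 ≤ ⟪e₁, e₃⟫ ≤ -1 + 1.09 η`.  With the relative rotations `e₁ē₂ = (C, S)`, `e₃ē₂ = (C₂, T)`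
one has `⟪e₁, e₃⟫ = C C₂ + S T`; `S T ≥ 0` is excluded (`linkQ_sameSenseA`), and for `S T < 0`
`2 (1 + ⟪e₁, e₃⟫) = (C + C₂)² + (|S| - |T|)²` (`linkQ_antipodalCore`). [folklore] -/
theorem linkQ_antipodal {η x₁ y₁ x₂ y₂ x₃ y₃ : ℝ} (hη0 : 0 ≤ η) (hη : η ≤ 1 / 1000)
    (h₁ : x₁ ^ 2 + y₁ ^ 2 = 1) (h₂ : x₂ ^ 2 + y₂ ^ 2 = 1) (h₃ : x₃ ^ 2 + y₃ ^ 2 = 1)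
    (c₁₂ : |x₁ * x₂ + y₁ * y₂ - 1 / 3| ≤ 9.5 * η) (s₂₃ : |x₂ * x₃ + y₂ * y₃ + 1 / 3| ≤ 33.7 * η)
    (f₁₃ : x₁ * x₃ + y₁ * y₃ ≤ -0.136) :
    -1 ≤ x₁ * x₃ + y₁ * y₃ ∧ x₁ * x₃ + y₁ * y₃ ≤ -1 + 1.09 * η := by
  refine ⟨by linarith [sq_nonneg (x₁ + x₃), sq_nonneg (y₁ + y₃)], ?_⟩
  -- relative rotations about `e₂`: `e₁ē₂ = (C, S)`, `e₃ē₂ = (C₂, T)`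
  have hCS : (x₁ * x₂ + y₁ * y₂) ^ 2 + (x₂ * y₁ - y₂ * x₁) ^ 2 = 1 := by
    linear_combination (x₁ ^ 2 + y₁ ^ 2) * h₂ + h₁
  have hCT : (x₂ * x₃ + y₂ * y₃) ^ 2 + (x₂ * y₃ - y₂ * x₃) ^ 2 = 1 := by
    linear_combination (x₃ ^ 2 + y₃ ^ 2) * h₂ + h₃
  have e₁₃ : (x₁ * x₂ + y₁ * y₂) * (x₂ * x₃ + y₂ * y₃) + (x₂ * y₁ - y₂ * x₁) * (x₂ * y₃ - y₂ * x₃)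
      = x₁ * x₃ + y₁ * y₃ := by
    linear_combination (x₁ * x₃ + y₁ * y₃) * h₂
  set C := x₁ * x₂ + y₁ * y₂ with hC
  set S := x₂ * y₁ - y₂ * x₁ with hS
  set C₂ := x₂ * x₃ + y₂ * y₃ with hC₂
  set T := x₂ * y₃ - y₂ * x₃ with hT
  rw [← e₁₃] at f₁₃ ⊢
  obtain ⟨hCl, hCu⟩ := abs_le.mp c₁₂
  obtain ⟨hDl, hDu⟩ := abs_le.mp s₂₃
  have hST : S * T < 0 := by
    by_contra h
    exact linkQ_sameSenseA (by linarith) (by linarith) (by linarith) (not_lt.mp h) f₁₃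
  have hστ : |S| * |T| = -(S * T) := by rw [← abs_mul, abs_of_neg hST]
  have hσ2 : |S| ^ 2 = 1 - C ^ 2 := by rw [sq_abs]; linear_combination hCS
  have hτ2 : |T| ^ 2 = 1 - C₂ ^ 2 := by rw [sq_abs]; linear_combination hCT
  have key : 2 * (1 + (C * C₂ + S * T)) = (C + C₂) ^ 2 + (|S| - |T|) ^ 2 := by
    linear_combination (-1 : ℝ) * sq_abs S - sq_abs T + 2 * hστ - hCS - hCT
  have core := linkQ_antipodalCore hη0 hη c₁₂ s₂₃ (linkQ_sinContact hη0 hη c₁₂ (abs_nonneg S) hσ2).1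
    (linkQ_sinSquare hη s₂₃ (abs_nonneg T) hτ2) hσ2 hτ2
  linarith

/-- **Two contacts make `141°`, to first order.**  Unit vectors `e₁, e₂, e₃` of the plane with
`⟪e₁, e₂⟫, ⟪e₂, e₃⟫ = 1/3 ± 9.5 η` and `⟪e₁, e₃⟫ ≤ -0.136`: then `⟪e₁, e₃⟫ = -7/9 ± 12.9 η`
(`⟪e₁, e₃⟫ = C C₂ - |S| |T|` with `|S| |T| = 8/9 ± (2/3 · 9.5 η + (9.5 η)²)`). [folklore] -/
theorem linkQ_twoContacts {η x₁ y₁ x₂ y₂ x₃ y₃ : ℝ} (hη0 : 0 ≤ η) (hη : η ≤ 1 / 1000)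
    (h₁ : x₁ ^ 2 + y₁ ^ 2 = 1) (h₂ : x₂ ^ 2 + y₂ ^ 2 = 1) (h₃ : x₃ ^ 2 + y₃ ^ 2 = 1)
    (c₁₂ : |x₁ * x₂ + y₁ * y₂ - 1 / 3| ≤ 9.5 * η) (c₂₃ : |x₂ * x₃ + y₂ * y₃ - 1 / 3| ≤ 9.5 * η)
    (f₁₃ : x₁ * x₃ + y₁ * y₃ ≤ -0.136) : |x₁ * x₃ + y₁ * y₃ + 7 / 9| ≤ 12.9 * η := by
  have hCS : (x₁ * x₂ + y₁ * y₂) ^ 2 + (x₂ * y₁ - y₂ * x₁) ^ 2 = 1 := by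
    linear_combination (x₁ ^ 2 + y₁ ^ 2) * h₂ + h₁
  have hCT : (x₂ * x₃ + y₂ * y₃) ^ 2 + (x₂ * y₃ - y₂ * x₃) ^ 2 = 1 := by
    linear_combination (x₃ ^ 2 + y₃ ^ 2) * h₂ + h₃
  have e₁₃ : (x₁ * x₂ + y₁ * y₂) * (x₂ * x₃ + y₂ * y₃) + (x₂ * y₁ - y₂ * x₁) * (x₂ * y₃ - y₂ * x₃)
      = x₁ * x₃ + y₁ * y₃ := by
    linear_combination (x₁ * x₃ + y₁ * y₃) * h₂
  set C := x₁ * x₂ + y₁ * y₂ with hC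
  set S := x₂ * y₁ - y₂ * x₁ with hS
  set C₂ := x₂ * x₃ + y₂ * y₃ with hC₂
  set T := x₂ * y₃ - y₂ * x₃ with hT
  rw [← e₁₃] at f₁₃ ⊢
  obtain ⟨hCl, hCu⟩ := abs_le.mp c₁₂
  obtain ⟨hDl, hDu⟩ := abs_le.mp c₂₃
  have hST : S * T < 0 := by
    by_contra h
    nlinarith [not_lt.mp h, mul_nonneg (by linarith : 0 ≤ C) (by linarith : 0 ≤ C₂)]
  have hστ : |S| * |T| = -(S * T) := by rw [← abs_mul, abs_of_neg hST]
  have hσ2 : |S| ^ 2 = 1 - C ^ 2 := by rw [sq_abs]; linear_combination hCS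
  have hτ2 : |T| ^ 2 = 1 - C₂ ^ 2 := by rw [sq_abs]; linear_combination hCT
  obtain ⟨-, hσl, hσu⟩ := linkQ_sinContact hη0 hη c₁₂ (abs_nonneg S) hσ2
  obtain ⟨-, hτl, hτu⟩ := linkQ_sinContact hη0 hη c₂₃ (abs_nonneg T) hτ2
  obtain ⟨hXl, hXu⟩ := linkQ_between (abs_nonneg S) (abs_nonneg T) hσl hσu hτl hτu
  obtain ⟨hPl, hPu⟩ := abs_le.mp (linkQ_mulThird hη c₁₂ c₂₃)
  have hη2 : (9.5 * η) ^ 2 ≤ 0.1 * η := by nlinarith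
  rw [abs_le]
  constructor <;> linarith

/-- **Planar part of the quantitative link lemma** (registered sub-goal `linkQ_planar`, one line):
`linkQ_antipodal` and `linkQ_twoContacts` with explicit binders. [folklore] -/
theorem linkQ_planar : (∀ (η x₁ y₁ x₂ y₂ x₃ y₃ : ℝ), 0 ≤ η → η ≤ 1 / 1000 → x₁ ^ 2 + y₁ ^ 2 = 1 → x₂ ^ 2 + y₂ ^ 2 = 1 → x₃ ^ 2 + y₃ ^ 2 = 1 → |x₁ * x₂ + y₁ * y₂ - 1 / 3| ≤ 9.5 * η → |x₂ * x₃ + y₂ * y₃ + 1 / 3| ≤ 33.7 * η → x₁ * x₃ + y₁ * y₃ ≤ -0.136 → -1 ≤ x₁ * x₃ + y₁ * y₃ ∧ x₁ * x₃ + y₁ * y₃ ≤ -1 + 1.09 * η) ∧ (∀ (η x₁ y₁ x₂ y₂ x₃ y₃ : ℝ), 0 ≤ η → η ≤ 1 / 1000 → x₁ ^ 2 + y₁ ^ 2 = 1 → x₂ ^ 2 + y₂ ^ 2 = 1 → x₃ ^ 2 + y₃ ^ 2 = 1 → |x₁ * x₂ + y₁ * y₂ - 1 / 3| ≤ 9.5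 * η → |x₂ * x₃ + y₂ * y₃ - 1 / 3| ≤ 9.5 * η → x₁ * x₃ + y₁ * y₃ ≤ -0.136 → |x₁ * x₃ + y₁ * y₃ + 7 / 9| ≤ 12.9 * η) :=
  ⟨fun _ _ _ _ _ _ _ hη0 hη h₁ h₂ h₃ c₁₂ s₂₃ f₁₃ => linkQ_antipodal hη0 hη h₁ h₂ h₃ c₁₂ s₂₃ f₁₃,
    fun _ _ _ _ _ _ _ hη0 hη h₁ h₂ h₃ c₁₂ c₂₃ f₁₃ => linkQ_twoContacts hη0 hη h₁ h₂ h₃ c₁₂ c₂₃ f₁₃⟩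

end Summit.AtomisticToContinuum.Crystallization.Theorems.ZeroDefectDensityBirth
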